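import Literature.IUT.HodgeTheaters.StableCurveTemperedDataOfSpecialFibreSec2OneCallA3Prime
import HarnessLib

/-!
# The §2 one-call's last law in PRINT-FAITHFUL form: the [AbsTopII] Prop 1.3 (iv) / [NodNon] Prop 3.9 (i) trichotomy
# in coset coordinates over the arithmetic decomposition data, and the printed step «still sufficient to conclude
# the temperedness» as a KERNEL theorem ([IUTchI] Prop. 2.4 (ii), p. 50 l. 64 – p. 51 l. 8)

S. Mochizuki, *Inter-universal Teichmüller theory I*, kurims manuscript (May 2020), §2, proof of Prop. 2.4 (ii),
p. 50 l. 64 – p. 51 l. 8 [cite: Mochizuki2012, Prop 2.4(ii) pp.50-51] (D-0012 claim key, status disputed; the content of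
this file is elementary topological group theory plus bookkeeping and takes no side):

> "Here, we note that when one applies either [AbsTopII], Proposition 1.3, (iv), or [NodNon], Proposition 3.9, (i) —
> after, say, restricting the outer action of `G_k` on `Π^tp_{𝔾*}` to a closed pro-`Σ` subgroup of the inertia group
> `I_k` of `G_k` that maps isomorphically onto the maximal pro-`Σ` quotient of `I_k` — to the vertices “`v″`”, “`(v′)^γ`”,
> one may only conclude that these two vertices either *coincide*, are *adjacent*, or *admit a common adjacent vertex*;
> but this is still sufficient to conclude the *temperedness* of “`(v′)^γ`” from that of “`v″`”."

over Y. Hoshi, S. Mochizuki, *On the combinatorial anabelian geometry of nodally nondegenerate outer representations*,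
Hiroshima Math. J. **41** (2011), Prop. 3.9 (i) p. 322 (kurims ms p. 48: for pro-vertices `ṽ₁, ṽ₂` of the profinite
universal covering, `δ(ṽ₁, ṽ₂) ≤ 2 ⟺ D_ṽ₁ ∩ D_ṽ₂ ≠ {1}`; Def 1.1 (vi) p. 285, Lem 1.7 / Lem 1.8 p. 290 for the end-points)
[cite: HoshiMochizukiNodNon2011, Prop 3.9 (i) p.322], S. Mochizuki, *Topics in absolute anabelian geometry II*,
J. Math. Sci. Univ. Tokyo **20** (2013), Prop. 1.3 (iv) p. 11 (the trichotomy with its refined clauses "for appropriate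
choices of conjugates") [cite: MochizukiAbsTopII2013, Prop 1.3 (iv) p.11], and [SemiAnbd] Rmk 5.3.1 p. 65 ("all verticial
and edge-like subgroups of `Π^temp_𝔊` are compact and arithmetically ample") [cite: MochizukiSemiAnbd2006, Rmk 5.3.1, p. 65].

PROOF-ONLY sequel (abc-iut cell, seat abc-iut-L5-t11 gen 15, row «SEC2-A3-TRICHOTOMY-TRANSFER») of abc-iut-w4-d058
gen 11's `StableCurveTemperedDataOfSpecialFibreSec2OneCallA3Prime.lean` (p500641) over abc-iut-L5-t11 gen 14's p496636 and
w4-d058 gen 10's p496462; no definition, no instance, no notation, no new `Prop` fact.  STATE OF RECORD: the §2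
one-call carries the laws `hNN_i · hab · hadm · hI_j^frame` and ONE binder still counted as a LAW by abc-iut-L5-lead
RULINGS #119 (3), in two kernel-equivalent spellings — `hA3ar_j` ((A3-arith) in coset form over FREE node data,
p493190/p496636) ⟺ (A3′)_j ("temperedness transfer": `γΛ̄γ⁻¹ ≤ g·ι(D_v)·g⁻¹ ∩ h·ι(D_w)·h⁻¹ ⇒ g⁻¹h ∈ ι(Π^tp_j)`, p500641).
Neither spelling is the PRINTED statement: print applies the TRICHOTOMY of [AbsTopII] Prop 1.3 (iv) / [NodNon]
Prop 3.9 (i) to the pro-vertices of the PROFINITE tree — stabilisers the CLOSURES `closure ι(D_v) ≤ Π̂_j`, end-points of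
pro-edges bound to the graph's own edges — and then says this is «still sufficient to conclude the temperedness».
This file types the printed trichotomy as the displayed law and PROVES the «still sufficient» step:

* § A (generic, namespace `ArithTrichotomyTransfer`): `topologicalClosure_map_eq_of_isCompact` — for a COMPACT
  `D_v` ([SemiAnbd] Rmk 5.3.1) and a continuous `ι` into a Hausdorff group, `closure ι(D_v) = ι(D_v)`;
  `isCompact_vertGp_of_verticialEdgeLikeCompactAmple` — compactness of every `D.vertGp v` from abc-iut-L3's typed
  Rmk 5.3.1 predicate `VerticialEdgeLikeCompactAmpleStatement` BY NAME.
* § B (the genuine 𝔛-datum; new binders as SECTION VARIABLES, documented there): `hVc_j` (Rmk 5.3.1, compactness of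
  the level-`j` verticial decomposition groups), arithmetic ENDPOINT DATA of `Dd j` (the `DecompositionData` twin of
  F-2540's `PSCDatum.EndpointData`: node data BOUND to `Dd j`'s own edges, with the no-loop clause and coverage), and
  the law `hA3tri_j` = the trichotomy AS PRINTED, quantified over ALL endpoint data, stabilisers = CLOSURES.  Theorems:
  `A3prime_of_trichotomy_of_isCompact` — `hVc_j ∧ hA3tri_j ⇒ (A3′)_j` verbatim (closures = images by § A, then
  w4-d058's `inv_mul_mem_range_of_cosetTreeNear` BY NAME): the printed «still sufficient» sentence, kernel-checked,
  the compactness being exactly where the temperedness of `v″` enters; and the two one-calls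
  `prop24_cor25_ofPiData_byName_noRF_frame_of_freePro_trichotomy` ((x)-keyed, via p500641 over p496636) and
  `…_of_isFreeOrSurface_trichotomy` ((x′)-keyed, via p500641 over p496462).
  Law census after this file (labels of RULINGS #119 (3)): `hNN_i` F-2540 BY NAME · `hab` ORIGIN (G-L5t11g7-1) ·
  `hadm` GAP (G-w4d058-g10-1) · `hI_j^frame` abc-iut-L3 Thm 5.4 (i) predicate BY NAME · `hVc_j` Rmk 5.3.1 (BY NAME from
  `VerticialEdgeLikeCompactAmpleStatement`, § A) · `hA3tri_j` = [AbsTopII] Prop 1.3 (iv)-refined / [NodNon] Prop 3.9 (i)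
  SHAPE at the genuine level-`j` arithmetic datum (F-0276's typed `Prop13iv'` carries the vertex-level trichotomy
  only — "refined clauses not typed") · (x)/(x′).

HONEST TAGS.  NOT claimed: that the trichotomy HOLDS at the genuine datum (a FACT-class input: nodal nondegeneracy
of the inertia action on the special fibre, [NodNon] §§2–3), nor anything of [SemiAnbd] Thm 5.4; these stay displayed
hypotheses.  CONDITIONAL as labelled; typed ≠ inhabited ≠ discharged; nothing here asserts that abc is proved or
refuted, and nothing here bears on [IUTchIII] Cor. 3.12.
-/

noncomputable section

namespace Literature.IUT.HodgeTheaters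

open _root_.Topology
open scoped Pointwise
open Literature.AnabelianGeometry.SemiGraphs Literature.AnabelianGeometry.SemiGraphs.ProfiniteSemiGraph
open Literature.AnabelianGeometry.SemiGraphs.SemiGraphOfAnabelioids (IsProSigmaCompletion)

universe uE

/-! ### A. Generic: compact verticial decomposition groups have closed images ([SemiAnbd] Rmk 5.3.1) -/

namespace ArithTrichotomyTransfer

variable {Gtp : Type*} [Group Gtp] [TopologicalSpace Gtp]
  {Ghat : Type*} [Group Ghat] [TopologicalSpace Ghat] [IsTopologicalGroup Ghat]

/-- **A compact subgroup has a CLOSED image under a continuous homomorphism into a Hausdorff group**, so the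
closure of the image is the image: for a compact verticial decomposition group `D_v ≤ Π^temp` ([SemiAnbd]
Rmk 5.3.1: "all verticial … subgroups … are compact") the stabiliser `closure ι(D_v)` of the reference pro-vertex in
the profinite tree IS `ι(D_v)`. [cite: MochizukiSemiAnbd2006, Rmk 5.3.1, p. 65] -/
theorem topologicalClosure_map_eq_of_isCompact [T2Space Ghat] (ι : Gtp →* Ghat) (hι : Continuous ι)
    {K : Subgroup Gtp} (hK : IsCompact (K : Set Gtp)) :
    (K.map ι).topologicalClosure = K.map ι := by
  refine le_antisymm (Subgroup.topologicalClosure_minimal _ le_rfl ?_) (Subgroup.le_topologicalClosure _)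
  rw [Subgroup.coe_map]
  exact (hK.image hι).isClosed

/-- **Compactness of the verticial decomposition groups from [SemiAnbd] Rmk 5.3.1 BY NAME**: abc-iut-L3's typed
predicate `VerticialEdgeLikeCompactAmpleStatement D aug` ("all verticial and edge-like subgroups of `Π^temp_𝔊` are
compact and arithmetically ample") gives `IsCompact (D.vertGp v)` for every vertex (the conjugate by `1`).  This is
how the binder `hVc_j` of § B is met BY NAME. [cite: MochizukiSemiAnbd2006, Rmk 5.3.1, p. 65] -/
theorem isCompact_vertGp_of_verticialEdgeLikeCompactAmple {PA : Type*} [Group PA] [TopologicalSpace PA]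
    {V B : Type*} (D : DecompositionData Gtp V B) (aug : Gtp →* PA)
    (hR : VerticialEdgeLikeCompactAmpleStatement D aug) (v : V) :
    IsCompact ((D.vertGp v : Subgroup Gtp) : Set Gtp) := by
  have hconj : conjSubgroup (1 : Gtp) (D.vertGp v) = D.vertGp v := by
    ext x
    simp [conjSubgroup]
  exact (hR (D.vertGp v) (Or.inl ⟨v, 1, hconj.symm⟩)).1

end ArithTrichotomyTransfer

/-! ### B. The genuine 𝔛-datum: the trichotomy AS PRINTED, over endpoint data of `Dd j`, with compact verticial groups -/

namespace StableCurveTemperedData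

namespace OfSpecialFibre

variable {p : ℕ} [Fact p.Prime] (X : TemperedCurve p)

section OneCall

variable (d : X.GroupLevelData) (T : SpecialFibreTower X.DeltaTemp)
  (Sigma SigmaHat : Set ℕ) (hsub : Sigma ⊆ SigmaHat) (hne : Set.Nonempty Sigma)
  (hprime : ∀ q ∈ SigmaHat, q.Prime)
  (S : SpecialFibreData (X.toTemperedArithmeticGroup d)) (h36 : S.Gc.Prop36Hypotheses)
  (hp : p ∉ Sigma) (TpH : Subgroup S.chart.G)
  (HatH : Subgroup (TemperedGraphGroupData.exists_completion_of_prop36 S.Gc h36 S.chart).choose)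
  (hle : TpH.map (TemperedGraphGroupData.exists_completion_of_prop36 S.Gc h36
    S.chart).choose_spec.choose.toMonoidHom ≤ HatH)
  (cuspMeetsH : {x : X.Pt // X.IsCusp x} → Prop)

/-! #### The new binders (section variables, shared by the three theorems below)

* `Dd j` — the level-`j` arithmetic decomposition data over `Π^tp_j := Π^temp_{X_K} ⧸ admKer_j` (as in p493190);
* `hVc` — [SemiAnbd] Rmk 5.3.1, first sentence (compactness half): every `(Dd j).vertGp v` is COMPACT;
* arithmetic ENDPOINT DATA of `Dd j` — [NodNon] Def 1.1 (vi) with Lem 1.7 / Lem 1.8 in coset coordinates, the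
  `DecompositionData` twin of F-2540's `PSCDatum.EndpointData`: an index type `EA j` of nodes; for each `e : EA j` two
  DISTINCT branches `β₁A j e ≠ β₂A j e` of ONE edge of `Dd j` (`hβe`, `hβne`) abutting to the vertices `srcA j e`,
  `tgtA j e` (`hsrcA`, `htgtA`); tempered end-point conjugators `c₁A j e, c₂A j e ∈ Π^tp_j` such that
  `c₁A·Π_{β₁A e}·c₁A⁻¹ = c₂A·Π_{β₂A e}·c₂A⁻¹` (`hΓA`: the reference pro-edge `ẽ_e := c₁A e · (branch β₁A e at ṽ_src)`
  `= c₂A e · (branch β₂A e at ṽ_tgt)` has end-points `c₁A e·ṽ_{src}`, `c₂A e·ṽ_{tgt}`); the no-loop clause `hloopA`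
  ([NodNon] Lem 1.8: the two end-points are distinct pro-vertices); and `hcovA`: every node of `Dd j` (pair of distinct
  branches of one edge, both abutting) is indexed;
* `hA3tri` — the LAW: [AbsTopII] Prop 1.3 (iv) with its refined clauses / [NodNon] Prop 3.9 (i) in coset coordinates,
  quantified over ALL endpoint data of `Dd j`, the pro-vertex stabilisers being the CLOSURES `closure ι_j(D_v) ≤ Π̂_j`:
  if a `Π̂_j`-conjugate `γ Λ̄_j γ⁻¹` of the image of a compact `Λ ≤ Π^temp_{X_K}` with open image in `G_K` lies in
  `g·closure ι_j(D_v)·g⁻¹` and in `h·closure ι_j(D_w)·h⁻¹`, then the pro-vertices `g·ṽ`, `h·w̃` COINCIDE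
  (`v = w ∧ g⁻¹h ∈ closure ι_j(D_v)`), are ADJACENT (end-points `k·ι_j(c₁ e)·p`, `k·ι_j(c₂ e)·q` of a pro-edge `k·ẽ_e`,
  `p ∈ closure ι_j(D_{src e})`, `q ∈ closure ι_j(D_{tgt e})`), or ADMIT A COMMON ADJACENT PRO-VERTEX `f·ũ`.
  A displayed hypothesis, NEVER asserted (FACT-class at the genuine datum). -/

variable (P : SpecialFibreTower.PiData X d S T) {V B : ℕ → Type*}
  (Dd : ∀ j, DecompositionData ((qTowerOfSpecialFibreTower X T d S h36 Sigma SigmaHat hsub hne hprime hp TpH HatH hle cuspMeetsH P.admKer_normal_pi).Q j).Tp (V j) (B j))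
  (hVc : ∀ (j : ℕ) (v : V j), IsCompact (((Dd j).vertGp v : Subgroup ((qTowerOfSpecialFibreTower X T d S h36 Sigma SigmaHat hsub hne hprime hp TpH HatH hle cuspMeetsH P.admKer_normal_pi).Q j).Tp) : Set ((qTowerOfSpecialFibreTower X T d S h36 Sigma SigmaHat hsub hne hprime hp TpH HatH hle cuspMeetsH P.admKer_normal_pi).Q j).Tp))
  {EA : ℕ → Type uE} (β₁A β₂A : ∀ j, EA j → B j) (srcA tgtA : ∀ j, EA j → V j)
  (c₁A c₂A : ∀ j, EA j → ((qTowerOfSpecialFibreTower X T d S h36 Sigma SigmaHat hsub hne hprime hp TpH HatH hle cuspMeetsH P.admKer_normal_pi).Q j).Tp)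
  (hβe : ∀ j e, (Dd j).edgeOf (β₁A j e) = (Dd j).edgeOf (β₂A j e)) (hβne : ∀ j e, β₁A j e ≠ β₂A j e)
  (hsrcA : ∀ j e, (Dd j).abut (β₁A j e) = some (srcA j e))
  (htgtA : ∀ j e, (Dd j).abut (β₂A j e) = some (tgtA j e))
  (hΓA : ∀ j e, MulAut.conj (c₁A j e) • (Dd j).brGp (β₁A j e) = MulAut.conj (c₂A j e) • (Dd j).brGp (β₂A j e))
  (hloopA : ∀ j e, srcA j e = tgtA j e → (c₁A j e)⁻¹ * c₂A j e ∉ (Dd j).vertGp (srcA j e))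
  (hcovA : ∀ (j : ℕ) (b b' : B j) (v w : V j), (Dd j).edgeOf b = (Dd j).edgeOf b' → b ≠ b' →
    (Dd j).abut b = some v → (Dd j).abut b' = some w →
      ∃ e, (β₁A j e = b ∧ β₂A j e = b') ∨ (β₁A j e = b' ∧ β₂A j e = b))
  (hA3tri : ∀ (j : ℕ) (E : Type uE) (β₁ β₂ : E → B j) (src tgt : E → V j) (c₁ c₂ : E → ((qTowerOfSpecialFibreTower X T d S h36 Sigma SigmaHat hsub hne hprime hp TpH HatH hle cuspMeetsH P.admKer_normal_pi).Q j).Tp),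
    (∀ e, (Dd j).edgeOf (β₁ e) = (Dd j).edgeOf (β₂ e)) → (∀ e, β₁ e ≠ β₂ e) →
    (∀ e, (Dd j).abut (β₁ e) = some (src e)) → (∀ e, (Dd j).abut (β₂ e) = some (tgt e)) →
    (∀ e, MulAut.conj (c₁ e) • (Dd j).brGp (β₁ e) = MulAut.conj (c₂ e) • (Dd j).brGp (β₂ e)) →
    (∀ e, src e = tgt e → (c₁ e)⁻¹ * c₂ e ∉ (Dd j).vertGp (src e)) →
    (∀ (b b' : B j) (v w : V j), (Dd j).edgeOf b = (Dd j).edgeOf b' → b ≠ b' →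
      (Dd j).abut b = some v → (Dd j).abut b' = some w → ∃ e, (β₁ e = b ∧ β₂ e = b') ∨ (β₁ e = b' ∧ β₂ e = b)) →
    ∀ (Λ : Subgroup X.PiTemp), IsCompact (Λ : Set X.PiTemp) → Λ ≠ ⊥ →
    IsOpen (Λ.map X.augGK.toMonoidHom : Set X.GK) →
    ∀ (v w : V j) (g h γ : ((qTowerOfSpecialFibreTower X T d S h36 Sigma SigmaHat hsub hne hprime hp TpH HatH hle cuspMeetsH P.admKer_normal_pi).Q j).Hat),
      MulAut.conj γ • Λ.map (((qTowerOfSpecialFibreTower X T d S h36 Sigma SigmaHat hsub hne hprime hp TpH HatH hle cuspMeetsH P.admKer_normal_pi).qhat j).comp X.toHat.toMonoidHom) ≤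
          MulAut.conj g • (((Dd j).vertGp v).map ((qTowerOfSpecialFibreTower X T d S h36 Sigma SigmaHat hsub hne hprime hp TpH HatH hle cuspMeetsH P.admKer_normal_pi).Q j).ι).topologicalClosure →
      MulAut.conj γ • Λ.map (((qTowerOfSpecialFibreTower X T d S h36 Sigma SigmaHat hsub hne hprime hp TpH HatH hle cuspMeetsH P.admKer_normal_pi).qhat j).comp X.toHat.toMonoidHom) ≤
          MulAut.conj h • (((Dd j).vertGp w).map ((qTowerOfSpecialFibreTower X T d S h36 Sigma SigmaHat hsub hne hprime hp TpH HatH hle cuspMeetsH P.admKer_normal_pi).Q j).ι).topologicalClosure →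
        (v = w ∧ g⁻¹ * h ∈ (((Dd j).vertGp v).map ((qTowerOfSpecialFibreTower X T d S h36 Sigma SigmaHat hsub hne hprime hp TpH HatH hle cuspMeetsH P.admKer_normal_pi).Q j).ι).topologicalClosure) ∨
        (∃ (e : E) (k : ((qTowerOfSpecialFibreTower X T d S h36 Sigma SigmaHat hsub hne hprime hp TpH HatH hle cuspMeetsH P.admKer_normal_pi).Q j).Hat), ∃ p ∈ (((Dd j).vertGp (src e)).map ((qTowerOfSpecialFibreTower X T d S h36 Sigma SigmaHat hsub hne hprime hp TpH HatH hle cuspMeetsH P.admKer_normal_pi).Q j).ι).topologicalClosure,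
              ∃ q ∈ (((Dd j).vertGp (tgt e)).map ((qTowerOfSpecialFibreTower X T d S h36 Sigma SigmaHat hsub hne hprime hp TpH HatH hle cuspMeetsH P.admKer_normal_pi).Q j).ι).topologicalClosure,
              (src e = v ∧ tgt e = w ∧ g = k * ((qTowerOfSpecialFibreTower X T d S h36 Sigma SigmaHat hsub hne hprime hp TpH HatH hle cuspMeetsH P.admKer_normal_pi).Q j).ι (c₁ e) * p ∧ h = k * ((qTowerOfSpecialFibreTower X T d S h36 Sigma SigmaHat hsub hne hprime hp TpH HatH hle cuspMeetsH P.admKer_normal_pi).Q j).ι (c₂ e) * q) ∨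
              (src e = w ∧ tgt e = v ∧ h = k * ((qTowerOfSpecialFibreTower X T d S h36 Sigma SigmaHat hsub hne hprime hp TpH HatH hle cuspMeetsH P.admKer_normal_pi).Q j).ι (c₁ e) * p ∧ g = k * ((qTowerOfSpecialFibreTower X T d S h36 Sigma SigmaHat hsub hne hprime hp TpH HatH hle cuspMeetsH P.admKer_normal_pi).Q j).ι (c₂ e) * q)) ∨
        (∃ (u : V j) (f : ((qTowerOfSpecialFibreTower X T d S h36 Sigma SigmaHat hsub hne hprime hp TpH HatH hle cuspMeetsH P.admKer_normal_pi).Q j).Hat),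
          (∃ (e : E) (k : ((qTowerOfSpecialFibreTower X T d S h36 Sigma SigmaHat hsub hne hprime hp TpH HatH hle cuspMeetsH P.admKer_normal_pi).Q j).Hat), ∃ p ∈ (((Dd j).vertGp (src e)).map ((qTowerOfSpecialFibreTower X T d S h36 Sigma SigmaHat hsub hne hprime hp TpH HatH hle cuspMeetsH P.admKer_normal_pi).Q j).ι).topologicalClosure,
              ∃ q ∈ (((Dd j).vertGp (tgt e)).map ((qTowerOfSpecialFibreTower X T d S h36 Sigma SigmaHat hsub hne hprime hp TpH HatH hle cuspMeetsH P.admKer_normal_pi).Q j).ι).topologicalClosure,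
              (src e = v ∧ tgt e = u ∧ g = k * ((qTowerOfSpecialFibreTower X T d S h36 Sigma SigmaHat hsub hne hprime hp TpH HatH hle cuspMeetsH P.admKer_normal_pi).Q j).ι (c₁ e) * p ∧ f = k * ((qTowerOfSpecialFibreTower X T d S h36 Sigma SigmaHat hsub hne hprime hp TpH HatH hle cuspMeetsH P.admKer_normal_pi).Q j).ι (c₂ e) * q) ∨
              (src e = u ∧ tgt e = v ∧ f = k * ((qTowerOfSpecialFibreTower X T d S h36 Sigma SigmaHat hsub hne hprime hp TpH HatH hle cuspMeetsH P.admKer_normal_pi).Q j).ι (c₁ e) * p ∧ g = k * ((qTowerOfSpecialFibreTower X T d S h36 Sigma SigmaHat hsub hne hprime hp TpH HatH hle cuspMeetsH P.admKer_normal_pi).Q j).ι (c₂ e) * q)) ∧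
          (∃ (e : E) (k : ((qTowerOfSpecialFibreTower X T d S h36 Sigma SigmaHat hsub hne hprime hp TpH HatH hle cuspMeetsH P.admKer_normal_pi).Q j).Hat), ∃ p ∈ (((Dd j).vertGp (src e)).map ((qTowerOfSpecialFibreTower X T d S h36 Sigma SigmaHat hsub hne hprime hp TpH HatH hle cuspMeetsH P.admKer_normal_pi).Q j).ι).topologicalClosure,
              ∃ q ∈ (((Dd j).vertGp (tgt e)).map ((qTowerOfSpecialFibreTower X T d S h36 Sigma SigmaHat hsub hne hprime hp TpH HatH hle cuspMeetsH P.admKer_normal_pi).Q j).ι).topologicalClosure,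
              (src e = u ∧ tgt e = w ∧ f = k * ((qTowerOfSpecialFibreTower X T d S h36 Sigma SigmaHat hsub hne hprime hp TpH HatH hle cuspMeetsH P.admKer_normal_pi).Q j).ι (c₁ e) * p ∧ h = k * ((qTowerOfSpecialFibreTower X T d S h36 Sigma SigmaHat hsub hne hprime hp TpH HatH hle cuspMeetsH P.admKer_normal_pi).Q j).ι (c₂ e) * q) ∨
              (src e = w ∧ tgt e = u ∧ h = k * ((qTowerOfSpecialFibreTower X T d S h36 Sigma SigmaHat hsub hne hprime hp TpH HatH hle cuspMeetsH P.admKer_normal_pi).Q j).ι (c₁ e) * p ∧ f = k * ((qTowerOfSpecialFibreTower X T d S h36 Sigma SigmaHat hsub hne hprime hp TpH HatH hle cuspMeetsH P.admKer_normal_pi).Q j).ι (c₂ e) * q))))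

include hVc hβe hβne hsrcA htgtA hΓA hloopA hcovA hA3tri in
/-- **The printed step «still sufficient to conclude the temperedness» as a KERNEL theorem** ([IUTchI] p. 51
l. 5–8): at the genuine 𝔛-datum, the trichotomy AS PRINTED (`hA3tri`, pro-vertex stabilisers = closures) together with
the COMPACTNESS of the level-`j` verticial decomposition groups (`hVc`, [SemiAnbd] Rmk 5.3.1) yields abc-iut-w4-d058
g11's E-free law (A3′)_j VERBATIM (p500641): «a `Π̂_j`-conjugate of `Λ̄_j` inside `g·ι_j(D_v)·g⁻¹ ∩ h·ι_j(D_w)·h⁻¹` forces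
`g⁻¹h ∈ ι_j(Π^tp_j)`».  PROOF: by `hVc` and `ArithTrichotomyTransfer.topologicalClosure_map_eq_of_isCompact` the closures
`closure ι_j(D_u)` ARE the images `ι_j(D_u) ≤ ι_j(Π^tp_j)` (`Π̂_j = Π_{X_K} ⧸ closure ι(admKer_j)` is Hausdorff), so the
image-form containments are closure-form containments and w4-d058's `inv_mul_mem_range_of_cosetTreeNear` (any node data,
stabilisers `≤ ι_j.range`) applies to the trichotomy at the displayed endpoint data.  CONDITIONAL on `hVc`, `hA3tri`
(displayed). [cite: Mochizuki2012, Prop 2.4(ii) p.51] [cite: HoshiMochizukiNodNon2011, Prop 3.9 (i) p.322] [claim: Mochizuki2012, status: disputed] -/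
theorem A3prime_of_trichotomy_of_isCompact :
    ∀ (j : ℕ) (Λ : Subgroup X.PiTemp), IsCompact (Λ : Set X.PiTemp) → Λ ≠ ⊥ →
      IsOpen (Λ.map X.augGK.toMonoidHom : Set X.GK) →
      ∀ (v w : V j) (g h γ : ((qTowerOfSpecialFibreTower X T d S h36 Sigma SigmaHat hsub hne hprime hp TpH HatH hle cuspMeetsH P.admKer_normal_pi).Q j).Hat),
        MulAut.conj γ • Λ.map (((qTowerOfSpecialFibreTower X T d S h36 Sigma SigmaHat hsub hne hprime hp TpH HatH hle cuspMeetsH P.admKer_normal_pi).qhat j).comp X.toHat.toMonoidHom) ≤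
            MulAut.conj g • ((Dd j).vertGp v).map ((qTowerOfSpecialFibreTower X T d S h36 Sigma SigmaHat hsub hne hprime hp TpH HatH hle cuspMeetsH P.admKer_normal_pi).Q j).ι →
        MulAut.conj γ • Λ.map (((qTowerOfSpecialFibreTower X T d S h36 Sigma SigmaHat hsub hne hprime hp TpH HatH hle cuspMeetsH P.admKer_normal_pi).qhat j).comp X.toHat.toMonoidHom) ≤
            MulAut.conj h • ((Dd j).vertGp w).map ((qTowerOfSpecialFibreTower X T d S h36 Sigma SigmaHat hsub hne hprime hp TpH HatH hle cuspMeetsH P.admKer_normal_pi).Q j).ι →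
          g⁻¹ * h ∈ ((qTowerOfSpecialFibreTower X T d S h36 Sigma SigmaHat hsub hne hprime hp TpH HatH hle cuspMeetsH P.admKer_normal_pi).Q j).ι.range := by
  intro j Λ hΛc hΛ1 hΛo v w g h γ hgv hhw
  haveI : (admKerHat X T j).Normal := admKerHat_normal X T j (P.admKer_normal_pi j)
  haveI : IsClosed ((admKerHat X T j : Subgroup X.PiHat) : Set X.PiHat) := Subgroup.isClosed_topologicalClosure _
  haveI : T2Space X.PiHat := X.isProfiniteCompletion_toHat.t2Space
  haveI : T2Space ((qTowerOfSpecialFibreTower X T d S h36 Sigma SigmaHat hsub hne hprime hp TpH HatH hle cuspMeetsH P.admKer_normal_pi).Q j).Hat := by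
    change T2Space (X.PiHat ⧸ admKerHat X T j)
    infer_instance
  -- [SemiAnbd] Rmk 5.3.1: compact verticial groups ⇒ the pro-vertex stabilisers `closure ι_j(D_u)` ARE `ι_j(D_u)`
  have hcl : ∀ u : V j, (((Dd j).vertGp u).map ((qTowerOfSpecialFibreTower X T d S h36 Sigma SigmaHat hsub hne hprime hp TpH HatH hle cuspMeetsH P.admKer_normal_pi).Q j).ι).topologicalClosure =
      ((Dd j).vertGp u).map ((qTowerOfSpecialFibreTower X T d S h36 Sigma SigmaHat hsub hne hprime hp TpH HatH hle cuspMeetsH P.admKer_normal_pi).Q j).ι :=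
    fun u => ArithTrichotomyTransfer.topologicalClosure_map_eq_of_isCompact _
      ((qTowerOfSpecialFibreTower X T d S h36 Sigma SigmaHat hsub hne hprime hp TpH HatH hle cuspMeetsH P.admKer_normal_pi).Q j).ι_continuous (hVc j u)
  have hrange : ∀ u : V j, (((Dd j).vertGp u).map ((qTowerOfSpecialFibreTower X T d S h36 Sigma SigmaHat hsub hne hprime hp TpH HatH hle cuspMeetsH P.admKer_normal_pi).Q j).ι).topologicalClosure ≤
      ((qTowerOfSpecialFibreTower X T d S h36 Sigma SigmaHat hsub hne hprime hp TpH HatH hle cuspMeetsH P.admKer_normal_pi).Q j).ι.range :=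
    fun u => (hcl u).le.trans (Subgroup.map_le_range _ _)
  have hgv' : MulAut.conj γ • Λ.map (((qTowerOfSpecialFibreTower X T d S h36 Sigma SigmaHat hsub hne hprime hp TpH HatH hle cuspMeetsH P.admKer_normal_pi).qhat j).comp X.toHat.toMonoidHom) ≤
      MulAut.conj g • (((Dd j).vertGp v).map ((qTowerOfSpecialFibreTower X T d S h36 Sigma SigmaHat hsub hne hprime hp TpH HatH hle cuspMeetsH P.admKer_normal_pi).Q j).ι).topologicalClosure :=
    hgv.trans (Subgroup.pointwise_smul_le_pointwise_smul_iff.mpr (Subgroup.le_topologicalClosure _))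
  have hhw' : MulAut.conj γ • Λ.map (((qTowerOfSpecialFibreTower X T d S h36 Sigma SigmaHat hsub hne hprime hp TpH HatH hle cuspMeetsH P.admKer_normal_pi).qhat j).comp X.toHat.toMonoidHom) ≤
      MulAut.conj h • (((Dd j).vertGp w).map ((qTowerOfSpecialFibreTower X T d S h36 Sigma SigmaHat hsub hne hprime hp TpH HatH hle cuspMeetsH P.admKer_normal_pi).Q j).ι).topologicalClosure :=
    hhw.trans (Subgroup.pointwise_smul_le_pointwise_smul_iff.mpr (Subgroup.le_topologicalClosure _))
  have htri := hA3tri j (EA j) (β₁A j) (β₂A j) (srcA j) (tgtA j) (c₁A j) (c₂A j) (hβe j) (hβne j) (hsrcA j)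
    (htgtA j) (hΓA j) (hloopA j) (hcovA j) Λ hΛc hΛ1 hΛo v w g h γ hgv' hhw'
  exact inv_mul_mem_range_of_cosetTreeNear ((qTowerOfSpecialFibreTower X T d S h36 Sigma SigmaHat hsub hne hprime hp TpH HatH hle cuspMeetsH P.admKer_normal_pi).Q j).ι
    (fun u => (((Dd j).vertGp u).map ((qTowerOfSpecialFibreTower X T d S h36 Sigma SigmaHat hsub hne hprime hp TpH HatH hle cuspMeetsH P.admKer_normal_pi).Q j).ι).topologicalClosure) hrange
    (srcA j) (tgtA j) (c₁A j) (c₂A j) (v := v) (w := w) (g := g) (h := h) htri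

include hVc hβe hβne hsrcA htgtA hΓA hloopA hcovA hA3tri in
/-- **[IUTchI] Prop. 2.4 (i)(ii)(iii) ∧ Cor. 2.5 at the genuine 𝔛-datum, (x)-keyed, with the last law in PRINT-FAITHFUL
form**: abc-iut-L5-t11 gen 14's one-call (p496636) through w4-d058 g11's `…_of_freePro_A3prime` (p500641), the E-free
law (A3′)_j SUPPLIED by `A3prime_of_trichotomy_of_isCompact`.  Displayed laws: `hNN_i` (F-2540 BY NAME) · `hab` (ORIGIN,
G-L5t11g7-1) · `hadm` (GAP G-w4d058-g10-1) · `hI_j^frame` (abc-iut-L3 [SemiAnbd] Thm 5.4 (i) predicate at the canonical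
frame) · `hVc_j` ([SemiAnbd] Rmk 5.3.1; BY NAME from `VerticialEdgeLikeCompactAmpleStatement`, § A) · `hA3tri_j` (the
[AbsTopII] Prop 1.3 (iv)-refined / [NodNon] Prop 3.9 (i) SHAPE at the genuine level-`j` arithmetic datum, over endpoint
data of `Dd j`) + the origin binder (x) `hι` (GAP G-w4d052-g6-2).  CONDITIONAL as labelled; the trichotomy and Thm 5.4 (i)
are NOT proved here. [cite: Mochizuki2012, Prop 2.4 pp.50-51] [cite: Mochizuki2012, Cor 2.5 p.51] [claim: Mochizuki2012, status: disputed] -/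
theorem prop24_cor25_ofPiData_byName_noRF_frame_of_freePro_trichotomy (x : {x : X.Pt // X.IsCusp x})
    {Γ : Type*} [Group Γ] [IsFreeGroup Γ] {ι : Γ →* X.DeltaHat} (hι : IsProSigmaCompletion {q | q.Prime} ι)
    (G : ∀ i, PSCDatum (levelGraph X T Sigma SigmaHat hsub hne hprime i).Hat)
    (hNN : ∀ i, (G i).VerticialIntersectionNear)
    (σ : ∀ i, (T.Gc i).graph.Vertex ≃ (G i).graph.V) (Λv : ∀ i, (G i).graph.V → Subgroup (T.chart i).G)
    (hvert : ∀ i (v : (T.Gc i).graph.Vertex), Λv i (σ i v) ∈ verticialSubgroups (T.chart i) v)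
    (hΛv : ∀ i v, (Λv i v).map (levelGraph X T Sigma SigmaHat hsub hne hprime i).ι = (G i).vertGp v)
    (src tgt : ∀ i, (G i).graph.N → (G i).graph.V) (c₁ c₂ : ∀ i, (G i).graph.N → (T.chart i).G)
    (hends : ∀ i e, (G i).graph.nodeEnds e = s(src i e, tgt i e))
    (h₁ : ∀ i e, (G i).nodeGp e ≤
      MulAut.conj ((levelGraph X T Sigma SigmaHat hsub hne hprime i).ι (c₁ i e)) • (G i).vertGp (src i e))
    (h₂ : ∀ i e, (G i).nodeGp e ≤
      MulAut.conj ((levelGraph X T Sigma SigmaHat hsub hne hprime i).ι (c₂ i e)) • (G i).vertGp (tgt i e))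
    (hloop : ∀ i e, src i e = tgt i e → (c₁ i e)⁻¹ * c₂ i e ∉ Λv i (src i e))
    (hab : ∀ (i : ℕ) (A : Type) [CommGroup A] [Finite A] (χ : T.N i →* A),
      IsOpen ((χ.ker : Subgroup (T.N i)) : Set (T.N i)) →
      (∀ q : ℕ, q.Prime → q ∣ Nat.card A → q ∈ Sigma) → (T.adm i).toMonoidHom.ker ≤ χ.ker)
    (hadm : ∀ U ∈ 𝓝 (1 : ↥X.DeltaTemp), ∃ j, ((T.admKer j : Subgroup ↥X.DeltaTemp) : Set ↥X.DeltaTemp) ⊆ U)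
    (hI : ∀ j, haveI := qTower_map_N_normal X d T Sigma SigmaHat hsub hne hprime S h36 hp TpH HatH hle cuspMeetsH P j;
      ArithMaximalCompactStatementI (Dd j)
        (QuotientGroup.mk' (((T.N j).map X.DeltaTemp.subtype).map ((qTowerOfSpecialFibreTower X T d S h36 Sigma SigmaHat hsub hne hprime hp TpH HatH hle cuspMeetsH P.admKer_normal_pi).qtp j)))) :
    ((ofSpecialFibre X d S h36 Sigma SigmaHat hsub hne hprime hp TpH HatH hle cuspMeetsH).Prop24i ∧
      (ofSpecialFibre X d S h36 Sigma SigmaHat hsub hne hprime hp TpH HatH hle cuspMeetsH).Prop24ii ∧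
      (ofSpecialFibre X d S h36 Sigma SigmaHat hsub hne hprime hp TpH HatH hle cuspMeetsH).Prop24iii) ∧
    ((ofSpecialFibre X d S h36 Sigma SigmaHat hsub hne hprime hp TpH HatH hle cuspMeetsH).Cor25Decomposition ∧
      (ofSpecialFibre X d S h36 Sigma SigmaHat hsub hne hprime hp TpH HatH hle cuspMeetsH).Cor25Inertia) := by
  exact prop24_cor25_ofPiData_byName_noRF_frame_of_freePro_A3prime X d T Sigma SigmaHat hsub hne hprime S h36 hp TpH
    HatH hle cuspMeetsH P x hι G hNN σ Λv hvert hΛv src tgt c₁ c₂ hends h₁ h₂ hloop hab hadm Dd hI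
    (A3prime_of_trichotomy_of_isCompact X d T Sigma SigmaHat hsub hne hprime S h36 hp TpH HatH hle cuspMeetsH P Dd hVc β₁A β₂A srcA tgtA c₁A c₂A hβe hβne hsrcA htgtA hΓA hloopA hcovA hA3tri)

include hVc hβe hβne hsrcA htgtA hΓA hloopA hcovA hA3tri in
/-- **The (x′)-keyed twin** (abc-iut-w4-d058 gen 10's `…_of_isFreeOrSurface`, p496462, through p500641's
`…_of_isFreeOrSurface_A3prime`): the same one-call with the origin binder in the shape `IsFreeOrSurface F`,
`e : Δ̂_X ≃ₜ* F̂` and the last law PRINT-FAITHFUL (`hVc_j`, endpoint data, `hA3tri_j`).  CONDITIONAL as labelled.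
[cite: Mochizuki2012, Prop 2.4 pp.50-51] [cite: Mochizuki2012, Cor 2.5 p.51] [claim: Mochizuki2012, status: disputed] -/
theorem prop24_cor25_ofPiData_byName_noRF_frame_of_isFreeOrSurface_trichotomy (x : {x : X.Pt // X.IsCusp x})
    {F : Type} [Group F] (hF : IsFreeOrSurface F) (e : X.DeltaHat ≃ₜ* profiniteCompletion F)
    (G : ∀ i, PSCDatum (levelGraph X T Sigma SigmaHat hsub hne hprime i).Hat)
    (hNN : ∀ i, (G i).VerticialIntersectionNear)
    (σ : ∀ i, (T.Gc i).graph.Vertex ≃ (G i).graph.V) (Λv : ∀ i, (G i).graph.V → Subgroup (T.chart i).G)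
    (hvert : ∀ i (v : (T.Gc i).graph.Vertex), Λv i (σ i v) ∈ verticialSubgroups (T.chart i) v)
    (hΛv : ∀ i v, (Λv i v).map (levelGraph X T Sigma SigmaHat hsub hne hprime i).ι = (G i).vertGp v)
    (src tgt : ∀ i, (G i).graph.N → (G i).graph.V) (c₁ c₂ : ∀ i, (G i).graph.N → (T.chart i).G)
    (hends : ∀ i e, (G i).graph.nodeEnds e = s(src i e, tgt i e))
    (h₁ : ∀ i e, (G i).nodeGp e ≤
      MulAut.conj ((levelGraph X T Sigma SigmaHat hsub hne hprime i).ι (c₁ i e)) • (G i).vertGp (src i e))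
    (h₂ : ∀ i e, (G i).nodeGp e ≤
      MulAut.conj ((levelGraph X T Sigma SigmaHat hsub hne hprime i).ι (c₂ i e)) • (G i).vertGp (tgt i e))
    (hloop : ∀ i e, src i e = tgt i e → (c₁ i e)⁻¹ * c₂ i e ∉ Λv i (src i e))
    (hab : ∀ (i : ℕ) (A : Type) [CommGroup A] [Finite A] (χ : T.N i →* A),
      IsOpen ((χ.ker : Subgroup (T.N i)) : Set (T.N i)) →
      (∀ q : ℕ, q.Prime → q ∣ Nat.card A → q ∈ Sigma) → (T.adm i).toMonoidHom.ker ≤ χ.ker)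
    (hadm : ∀ U ∈ 𝓝 (1 : ↥X.DeltaTemp), ∃ j, ((T.admKer j : Subgroup ↥X.DeltaTemp) : Set ↥X.DeltaTemp) ⊆ U)
    (hI : ∀ j, haveI := qTower_map_N_normal X d T Sigma SigmaHat hsub hne hprime S h36 hp TpH HatH hle cuspMeetsH P j;
      ArithMaximalCompactStatementI (Dd j)
        (QuotientGroup.mk' (((T.N j).map X.DeltaTemp.subtype).map ((qTowerOfSpecialFibreTower X T d S h36 Sigma SigmaHat hsub hne hprime hp TpH HatH hle cuspMeetsH P.admKer_normal_pi).qtp j)))) :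
    ((ofSpecialFibre X d S h36 Sigma SigmaHat hsub hne hprime hp TpH HatH hle cuspMeetsH).Prop24i ∧
      (ofSpecialFibre X d S h36 Sigma SigmaHat hsub hne hprime hp TpH HatH hle cuspMeetsH).Prop24ii ∧
      (ofSpecialFibre X d S h36 Sigma SigmaHat hsub hne hprime hp TpH HatH hle cuspMeetsH).Prop24iii) ∧
    ((ofSpecialFibre X d S h36 Sigma SigmaHat hsub hne hprime hp TpH HatH hle cuspMeetsH).Cor25Decomposition ∧
      (ofSpecialFibre X d S h36 Sigma SigmaHat hsub hne hprime hp TpH HatH hle cuspMeetsH).Cor25Inertia) := by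
  exact prop24_cor25_ofPiData_byName_noRF_frame_of_isFreeOrSurface_A3prime X d T Sigma SigmaHat hsub hne hprime S h36
    hp TpH HatH hle cuspMeetsH P x hF e G hNN σ Λv hvert hΛv src tgt c₁ c₂ hends h₁ h₂ hloop hab hadm Dd hI
    (A3prime_of_trichotomy_of_isCompact X d T Sigma SigmaHat hsub hne hprime S h36 hp TpH HatH hle cuspMeetsH P Dd hVc β₁A β₂A srcA tgtA c₁A c₂A hβe hβne hsrcA htgtA hΓA hloopA hcovA hA3tri)

end OneCall

end OfSpecialFibre

end StableCurveTemperedData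

end Literature.IUT.HodgeTheaters

end
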